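import Literature.NumberTheory.Automorphic.NewformAdelisationHeckeOperator
import Literature.NumberTheory.Automorphic.SerreConjecture
import Literature.NumberTheory.EllipticCurves.NewformGaloisRep
import Summits.Langlands.Langlands.Theses.PhantomRMYoshida

/-!
# Sketch — crux `SerreKWAutomorphicGL2` (stmt-Langlands-12944), crux-ideate round 1, ideator 2

First lemmas of the idea cards, stated over existing declarations (no proofs; `def … : Prop`).
-/

noncomputable section

open scoped MatrixGroups Classical
open NumberField IsDedekindDomain Filter Polynomial
open Literature.NumberTheory.Automorphic Literature.NumberTheory.EllipticCurves.ModularForms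
  Literature.NumberTheory.GaloisRepresentations

namespace Summit.Langlands.Langlands.Cruxes.SerreKWAutomorphicGL2.Sketch

/-- **Card `lowest-weight-casimir-dictionary`, first lemma (the archimedean brick).**
The Borel–Jacquet datum generated by the adelic lift `φ_f` of a newform of weight `k ≥ 1` has
Harish-Chandra parameter `{(k-1)/2, (1-k)/2}` (read along `ι_𝔸 : GL₂(ℝ) → GL₂(𝔸_ℚ)`):
lowering operator kills `φ_f` (Cauchy–Riemann) ⇒ Casimir scalar `(k-1)²/2 - 1/2`, `Z = 0`
⇒ `GL2Casimir.hasHCParameter_of_lift_casimir_of_lift_zed`. -/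
def ArchParameterOfHolomorphicLift : Prop :=
  ∀ (N : ℕ) [NeZero N] (k : ℤ), 1 ≤ k →
    ∀ (f : CuspForm (CongruenceSubgroup.Gamma1 N) k), IsNewform1 f →
    ∀ (hcpt : isCompact_glFiniteIntegralLevel 2 ℚ),
      ∃ π : CuspidalAutomorphicRepData 2 ℚ hcpt,
        adelicLiftFunA N k ⇑f ∈ π.1.W ∧ adelicLiftFunA N k ⇑f ∉ π.1.W' ∧
        π.1.HasArchParameter (fun _ => ({((k : ℂ) - 1) / 2, (1 - (k : ℂ)) / 2} : Multiset ℂ))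

/-- **Card `lowest-weight-casimir-dictionary`, the dictionary in the crux's L-normalisation**
(output of the archimedean brick + the proved finite part + half-twist + nebentypus twist):
for a newform `f` of weight `k ≥ 1` (`k = 1`: limit of discrete series, parameter `{0,0}`) there is an L-algebraic cuspidal `π` of `GL₂(𝔸_ℚ)` whose
Satake parameter at almost every `p` is `{β₁⁻¹, β₂⁻¹}`, `β_j` the roots of the Hecke polynomial
`X² - a_p X + ε(p) p^{k-1}`, so that `arithFrobPolyOfSatake ι p 1 {β_j⁻¹} = ∏ (X - ι⁻¹ β_j)`. -/
def NewformDictionaryL : Prop :=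
  ∀ (N : ℕ) [NeZero N] (k : ℤ), 1 ≤ k →
    ∀ (f : CuspForm (CongruenceSubgroup.Gamma1 N) k), IsNewform1 f →
    ∀ (hcpt : isCompact_glFiniteIntegralLevel 2 ℚ),
      ∃ π : CuspidalAutomorphicRepData 2 ℚ hcpt, π.1.IsLAlgebraic ∧
        ∀ᶠ v : HeightOneSpectrum (𝓞 ℚ) in cofinite,
          let H : ℂ[X] :=
            X ^ 2 - C (heckeEigenvalue f (Rat.HeightOneSpectrum.primesEquiv v)) * X +
              C ((nebentypus f ((Rat.HeightOneSpectrum.primesEquiv v : Nat.Primes) : ℕ) : ℂ) *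
                (((Rat.HeightOneSpectrum.primesEquiv v : Nat.Primes) : ℕ) : ℂ) ^ (k - 1))
          π.1.HasSatakeParamAt v (H.roots.map (·⁻¹))

/-- **Alignment of the residual embedding** (decomposition-group transitivity): every ring
homomorphism from the integers `𝓞_f` of the (character-enlarged) coefficient field of `f` to an
algebraically closed `k` of characteristic `p` is `red ∘ ι⁻¹ ∘ τ` for some embedding
`τ : K_f →+* ℂ` (so that the KW coefficient map `ι_f` can be realised by `(ι, red)` after passing
to a Galois-conjugate eigenpacket). Pure algebraic number theory over Mathlib
(`Ideal.Quotient.stabilizerHom_surjective`, transitivity of `Gal` on primes over `p`). -/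
def ResidualEmbeddingAlignment : Prop :=
  ∀ (p : ℕ) [Fact p.Prime] (k : Type) [Field k] [CharP k p] [IsAlgClosed k]
    (red : Valued.integer (PadicAlgCl p) →+* k) (ι : PadicAlgCl p ≃+* ℂ)
    (N : ℕ) [NeZero N] (w : ℤ) (f : CuspForm (CongruenceSubgroup.Gamma1 N) w), IsNewform1 f →
    ∀ (j : coeffCharIntegers f →+* k),
      ∃ τ : coeffCharField f →+* ℂ,
        ∀ x : coeffCharIntegers f,
          ∃ hx : ι.symm (τ (x : coeffCharField f)) ∈ Valued.integer (PadicAlgCl p),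
            red ⟨ι.symm (τ (x : coeffCharField f)), hx⟩ = j x

/-- **Galois-conjugate eigenpackets are newform eigenpackets** (Diamond–Shurman Thm. 6.5.4 with
Thm. 5.8.2; from the tree's Hecke-stable rational structures `gamma0_exists_heckeStableDualLattice_holds`
/ `DeligneSerre1974_span_integralLattice1_holds` and `exists_isNewform1_of_eigenpacket`): for a
newform `f` and an embedding `τ : K_f →+* ℂ` there is a newform `g` (some level `M`, same weight)
whose Hecke polynomials at the primes `q ∤ N M` are the `τ`-conjugates of those of `f`. -/
def ConjugateNewformEigenpacket : Prop :=
  ∀ (N : ℕ) [NeZero N] (w : ℤ) (f : CuspForm (CongruenceSubgroup.Gamma1 N) w), IsNewform1 f →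
    ∀ τ : coeffCharField f →+* ℂ,
      ∃ (M : ℕ) (_ : NeZero M) (g : CuspForm (CongruenceSubgroup.Gamma1 M) w), IsNewform1 g ∧
        ∀ q : ℕ, q.Prime → ¬ q ∣ N * M →
          (heckePolynomial g q).map (algebraMap (coeffCharField g) ℂ) = (heckePolynomial f q).map τ

/-- The in-tree Galois-side Khare–Wintenberger fact, universally over `p` and `k`. -/
def KWWeakAllPrimes : Prop :=
  ∀ (p : ℕ) [Fact p.Prime] (k : Type) [Field k] [TopologicalSpace k] [DiscreteTopology k],
    exists_newform_of_odd_irreducible (p := p) (k := k)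

/-- **Shape of the line** (what the crux-plan skeleton's composition theorem will prove):
KW (in-tree named fact) + L-dictionary + alignment + conjugate eigenpackets ⇒ the crux decl. -/
def LineImplication : Prop :=
  KWWeakAllPrimes → NewformDictionaryL → ResidualEmbeddingAlignment → ConjugateNewformEigenpacket →
    Summit.Langlands.Langlands.Theses.PhantomRMYoshida.SerreKWAutomorphicGL2

/-- Sanity: the archimedean brick is the only non-algebraic input of `NewformDictionaryL`
(recorded as an implication to be proved in crux-plan; here only its statement). -/
def ArchBrickFeedsDictionary : Prop :=
  ArchParameterOfHolomorphicLift → NewformDictionaryL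

end Summit.Langlands.Langlands.Cruxes.SerreKWAutomorphicGL2.Sketch
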